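import Literature.Analysis.FluidPDE.CompressibleEulerImplosionCentreMajorantWindow2
import HarnessLib

/-!
# Buckmaster–Cao-Labora–Gómez-Serrano at `γ = 5/3`: the growth lemma of the centre series beyond order 200

Companion of `…OriginSeriesMajorant` / `…CentreMajorantWindow2` (crux `DenseExcursion`, line `sonic-cavity-renewal`,
tail engine of the centre expansion of the pinned profile). On the shooting window `r ∈ [13890041/12500000, 697/625]`
the kernel-certified scalar majorant `MAJW2` bounds `|w_j(r)|` for `j ≤ 200` (`abs_w_le_MAJW2`). This file extends the
bound to ALL orders by an analytic strong induction on the sharp step inequality `abs_w_succ_le_sharp` of the recursion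
(2.12) with the weights `Θ λ^j / j³`, `λ = 73/25`, `Θ = 1/400000`:

* `abs_w_le_growth`   : `60 < j → |w_j(r)| ≤ Θ λ^j / j³` for every `r` in the window;
* `abs_w_weight_le`   : `|w_j(r)|·(j+1)² ≤ λ^j` for every `j` (the form consumed by the analytic package of the series
  on the disc `|ζ| < 25/73`).

The inductive step at `n ≥ 200`: in `|w_{n+1}| ≤ 3/(n+1+πₙ)·[(|r−1| + |2−r|n)|wₙ| + Σ cᵢ|wᵢ|·j|wⱼ| + (πₙ/6)Σ|wᵢ||wⱼ|]`
(`i + j = n + 1`) every index `≤ 60` is bounded by the head data `h_i = MAJW2[i]3^i/2^80` and every index `> 60` by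
`Θλ^i/i³`; after division by `Θλ^{n+1}/(n+1)²` each contribution is bounded uniformly in `n ≥ 200` (the ratios
`(n+1)/(n+1−i)` decrease in `n`; the tail×tail convolutions are `≤ Σ_{i>60} 2/i³ + (2/61)Σ_{j>60} 1/j²` by telescoping),
and the resulting budget `L₀ + Q₁ + Q₂ + Q₃ + P₁₂ + P₃ = 0.9895… ≤ 1` is ONE exact rational inequality checked by the
kernel (`budget_ok`), as is `h_j j³ ≤ Θλ^j` for `60 < j ≤ 200` (`thetaChk_ok`). No facts, no axioms.

[cite: BuckmasterCaolaboraGomezserrano2025, Prop. 2.5, eq. (2.12), App. B]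
-/

noncomputable section

open Finset

namespace Literature.Analysis.FluidPDE

namespace BuckmasterCaolaboraGomezserrano2025

namespace OriginSeries

namespace CentreW2

set_option linter.style.longLine false
set_option linter.style.setOption false
set_option maxRecDepth 100000
set_option maxHeartbeats 4000000

/-! ### The certified constants (exact rationals, kernel side) -/

/-- Base `λ = 73/25` of the growth lemma. [folklore] -/
def lamQ : ℚ := 73 / 25

/-- Constant `Θ = 1/400000` of the growth lemma. [folklore] -/
def thetaQ : ℚ := 1 / 400000

/-- Head bound `h_i = MAJW2[i]·3^i/2^80 ≥ |w_i(r)|` (`i ≤ 200`). [cite: BuckmasterCaolaboraGomezserrano2025, App. B] -/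
def hQ (i : ℕ) : ℚ := (getZ MAJW2 i : ℚ) * 3 ^ i / 2 ^ 80

/-- `t_i = h_i / λ^i`. [folklore] -/
def tQ (i : ℕ) : ℚ := hQ i / lamQ ^ i

/-- `c_i ∈ {1/3, 1}` over `ℚ`. [cite: BuckmasterCaolaboraGomezserrano2025, eq. (2.11)] -/
def ccQ (i : ℕ) : ℚ := if i % 2 = 0 then 1 / 3 else 1

/-- Budget of the head×tail terms of the quadratic sum (`i = k + 1 ≤ 60`). [folklore] -/
def q1Q (k : ℕ) : ℚ := if k = 0 then 0 else 3 * ccQ (k + 1) * tQ (k + 1) * (201 / (200 - (k : ℚ))) ^ 2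

/-- Budget of the tail×head terms of the quadratic sum (`j = n − k ≤ 60`). [folklore] -/
def q2Q (j : ℕ) : ℚ := 3 * (j : ℚ) * tQ j * (201 / (201 - (j : ℚ))) ^ 2 / (201 - (j : ℚ))

/-- Budget of the head×tail terms of the parity sum (`i = k + 1 ≤ 60`). [folklore] -/
def p1Q (k : ℕ) : ℚ := tQ (k + 1) * (201 / (200 - (k : ℚ))) ^ 2 / (200 - (k : ℚ))

/-- Budget of the tail×head terms of the parity sum (`j = n − k ≤ 60`). [folklore] -/
def p2Q (j : ℕ) : ℚ := if j = 0 then 0 else tQ j * (201 / (201 - (j : ℚ))) ^ 2 / (201 - (j : ℚ))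

/-- Budget of the linear term. [folklore] -/
def L0Q : ℚ := 3 / lamQ * (72 / 625 / 200 + 556 / 625) * (201 / 200) ^ 2

/-- Budget of the tail×tail terms of the quadratic sum. [folklore] -/
def Q3Q : ℚ := 3 * thetaQ * (2 / 61 / 60 + 1 / (60 * 61))

/-- Budget of the tail×tail terms of the parity sum. [folklore] -/
def P3Q : ℚ := thetaQ * (4 / 61) / (2 * 60 * 61)

/-- Recursive finite sum of rationals (kernel friendly). [folklore] -/
def sumQ (f : ℕ → ℚ) : ℕ → ℚ
  | 0 => 0
  | n + 1 => sumQ f n + f n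

/-- [folklore] -/
theorem sumQ_eq (f : ℕ → ℚ) : ∀ n, sumQ f n = ∑ k ∈ range n, f k
  | 0 => by simp [sumQ]
  | n + 1 => by rw [sumQ, sumQ_eq f n, sum_range_succ]

/-- **The budget of the growth lemma** (one exact rational inequality, value `0.9895…`). [folklore] -/
theorem budget_ok : L0Q + (sumQ q1Q 60 + sumQ q2Q 61 + Q3Q) + (sumQ p1Q 60 + sumQ p2Q 61 + P3Q) ≤ 1 := by
  decide +kernel

/-- Kernel check of `h_j j³ ≤ Θ λ^j` for `j = 61, …, 60 + m`. [folklore] -/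
def thetaChk : ℕ → Bool
  | 0 => true
  | m + 1 => decide (hQ (61 + m) * ((61 + m : ℕ) : ℚ) ^ 3 ≤ thetaQ * lamQ ^ (61 + m)) && thetaChk m

/-- [folklore] -/
theorem thetaChk_ok : thetaChk 140 = true := by decide +kernel

/-- [folklore] -/
theorem of_thetaChk : ∀ m, thetaChk m = true → ∀ i, i < m → hQ (61 + i) * ((61 + i : ℕ) : ℚ) ^ 3 ≤ thetaQ * lamQ ^ (61 + i)
  | 0, _, i, hi => absurd hi (Nat.not_lt_zero _)
  | m + 1, h, i, hi => by
      simp only [thetaChk, Bool.and_eq_true, decide_eq_true_eq] at h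
      rcases Nat.lt_succ_iff_lt_or_eq.mp hi with hlt | rfl
      · exact of_thetaChk m h.2 i hlt
      · exact h.1

/-- `h_j j³ ≤ Θ λ^j` for `60 < j ≤ 200`. [folklore] -/
theorem hQ_le_theta {j : ℕ} (h1 : 60 < j) (h2 : j ≤ 200) : hQ j * (j : ℚ) ^ 3 ≤ thetaQ * lamQ ^ j := by
  obtain ⟨i, rfl⟩ : ∃ i, j = 61 + i := ⟨j - 61, by omega⟩
  exact of_thetaChk 140 thetaChk_ok i (by omega)

/-- Kernel check of `h_j (j+1)² ≤ λ^j` for `j < m`. [folklore] -/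
def headChk : ℕ → Bool
  | 0 => true
  | m + 1 => decide (hQ m * (((m : ℚ) + 1) ^ 2) ≤ lamQ ^ m) && headChk m

/-- [folklore] -/
theorem headChk_ok : headChk 61 = true := by decide +kernel

/-- [folklore] -/
theorem of_headChk : ∀ m, headChk m = true → ∀ i, i < m → hQ i * (((i : ℚ) + 1) ^ 2) ≤ lamQ ^ i
  | 0, _, i, hi => absurd hi (Nat.not_lt_zero _)
  | m + 1, h, i, hi => by
      simp only [headChk, Bool.and_eq_true, decide_eq_true_eq] at h
      rcases Nat.lt_succ_iff_lt_or_eq.mp hi with hlt | rfl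
      · exact of_headChk m h.2 i hlt
      · exact h.1

/-! ### Real-side constants -/

/-- [folklore] -/
theorem lamQ_cast : ((lamQ : ℚ) : ℝ) = 73 / 25 := by unfold lamQ; push_cast; ring

/-- [folklore] -/
theorem thetaQ_cast : ((thetaQ : ℚ) : ℝ) = 1 / 400000 := by unfold thetaQ; push_cast; ring

/-- [folklore] -/
theorem ccQ_cast (i : ℕ) : ((ccQ i : ℚ) : ℝ) = cc i := by
  unfold ccQ cc
  by_cases hi : i % 2 = 0
  · rw [if_pos hi, if_pos (Nat.even_iff.mpr hi)]; push_cast; ring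
  · rw [if_neg hi, if_neg (fun he => hi (Nat.even_iff.mp he))]; push_cast; ring

/-- [folklore] -/
theorem cc_le_one (i : ℕ) : cc i ≤ 1 := by unfold cc; split_ifs <;> norm_num

/-- [folklore] -/
theorem tQ_cast (i : ℕ) : ((tQ i : ℚ) : ℝ) = ((hQ i : ℚ) : ℝ) / (73 / 25 : ℝ) ^ i := by
  unfold tQ; push_cast; rw [lamQ_cast]

/-- The head bound in real form: `|w_i(r)| ≤ h_i` for `i ≤ 200`. [cite: BuckmasterCaolaboraGomezserrano2025, App. B] -/
theorem abs_w_le_hQ {r : ℝ} (hr : r ∈ Set.Icc ((13890041/12500000 : ℚ) : ℝ) ((697/625 : ℚ) : ℝ)) {i : ℕ} (hi : i ≤ 200) :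
    |w r 1 i| ≤ ((hQ i : ℚ) : ℝ) := by
  have h := abs_w_le_MAJW2 hr hi
  unfold hQ
  push_cast
  rw [le_div_iff₀ (by positivity)]
  simpa [PW2] using h

/-! ### The weight function of the induction -/

/-- The bound `B_i`: head data for `i ≤ 60`, `Θλ^i/i³` beyond. [folklore] -/
def Bb (i : ℕ) : ℝ := if i ≤ 60 then ((hQ i : ℚ) : ℝ) else (1 / 400000 : ℝ) * (73 / 25 : ℝ) ^ i / (i : ℝ) ^ 3

/-- [folklore] -/
theorem Bb_of_le {i : ℕ} (h : i ≤ 60) : Bb i = ((hQ i : ℚ) : ℝ) := by unfold Bb; rw [if_pos h]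

/-- [folklore] -/
theorem Bb_of_lt {i : ℕ} (h : 60 < i) : Bb i = (1 / 400000 : ℝ) * (73 / 25 : ℝ) ^ i / (i : ℝ) ^ 3 := by
  unfold Bb; rw [if_neg (by omega)]

/-- [folklore] -/
theorem Bb_nonneg_of_lt {i : ℕ} (h : 60 < i) : 0 ≤ Bb i := by rw [Bb_of_lt h]; positivity

/-- The base of the induction: `|w_i| ≤ B_i` for `i ≤ 200`. [cite: BuckmasterCaolaboraGomezserrano2025, App. B] -/
theorem abs_w_le_Bb_base {r : ℝ} (hr : r ∈ Set.Icc ((13890041/12500000 : ℚ) : ℝ) ((697/625 : ℚ) : ℝ)) {i : ℕ} (hi : i ≤ 200) :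
    |w r 1 i| ≤ Bb i := by
  by_cases h60 : i ≤ 60
  · rw [Bb_of_le h60]; exact abs_w_le_hQ hr hi
  · have h60' : 60 < i := by omega
    rw [Bb_of_lt h60']
    have h1 := abs_w_le_hQ hr hi
    have h2 := hQ_le_theta h60' hi
    have h2' : (((hQ i * (i : ℚ) ^ 3 : ℚ)) : ℝ) ≤ (((thetaQ * lamQ ^ i : ℚ)) : ℝ) := by exact_mod_cast h2
    push_cast at h2'
    rw [thetaQ_cast, lamQ_cast] at h2'
    have hi0 : (0 : ℝ) < (i : ℝ) ^ 3 := by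
      have : (0 : ℝ) < i := by exact_mod_cast (show 0 < i by omega)
      positivity
    rw [le_div_iff₀ hi0]
    calc |w r 1 i| * (i : ℝ) ^ 3 ≤ ((hQ i : ℚ) : ℝ) * (i : ℝ) ^ 3 :=
          mul_le_mul_of_nonneg_right h1 hi0.le
      _ ≤ 1 / 400000 * (73 / 25 : ℝ) ^ i := h2'

/-- The normalisation `U_n = Θ λ^{n+1}/(n+1)²`. [folklore] -/
def UU (n : ℕ) : ℝ := (1 / 400000 : ℝ) * (73 / 25 : ℝ) ^ (n + 1) / ((n : ℝ) + 1) ^ 2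

/-- [folklore] -/
theorem UU_pos (n : ℕ) : 0 < UU n := by unfold UU; positivity

/-! ### Elementary ratio inequalities (monotonicity in `n ≥ 200`) -/

/-- `(n+1)²(200−k)² ≤ 201²(n−k)²` for `n ≥ 200`, `k < 200`. [folklore] -/
theorem ratio_sq {n k : ℕ} (hn : 200 ≤ n) (hk : k < 200) :
    ((n : ℝ) + 1) ^ 2 * (200 - (k : ℝ)) ^ 2 ≤ 201 ^ 2 * ((n : ℝ) - k) ^ 2 := by
  have hn' : (200 : ℝ) ≤ n := by exact_mod_cast hn
  have hk' : (k : ℝ) + 1 ≤ 200 := by exact_mod_cast hk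
  have hk0 : (0 : ℝ) ≤ k := by positivity
  have h1 : ((n : ℝ) + 1) * (200 - (k : ℝ)) ≤ 201 * ((n : ℝ) - k) := by nlinarith
  have h0 : 0 ≤ ((n : ℝ) + 1) * (200 - (k : ℝ)) := by nlinarith
  have h2 := mul_le_mul h1 h1 h0 (by nlinarith)
  nlinarith [h2]

/-- `(n+1)²(201−j)³ ≤ 201²(n+1−j)³` for `n ≥ 200`, `j ≤ 200`. [folklore] -/
theorem ratio_cube {n j : ℕ} (hn : 200 ≤ n) (hj : j ≤ 200) :
    ((n : ℝ) + 1) ^ 2 * (201 - (j : ℝ)) ^ 3 ≤ 201 ^ 2 * ((n : ℝ) + 1 - j) ^ 3 := by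
  have hn' : (200 : ℝ) ≤ n := by exact_mod_cast hn
  have hj' : (j : ℝ) ≤ 200 := by exact_mod_cast hj
  have hj0 : (0 : ℝ) ≤ j := by positivity
  set u : ℝ := (n : ℝ) + 1 with hu
  set s : ℝ := 201 - (j : ℝ) with hs
  set v : ℝ := (n : ℝ) + 1 - j with hv
  have hu1 : 201 ≤ u := by rw [hu]; linarith
  have hs0 : 0 ≤ s := by rw [hs]; linarith
  have hv0 : 0 ≤ v := by rw [hv]; linarith
  have h1 : u * s ≤ 201 * v := by
    rw [hu, hs, hv]; nlinarith
  have h2 : (u * s) ^ 3 ≤ (201 * v) ^ 3 := pow_le_pow_left₀ (by positivity) h1 3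
  have h3 : 201 * (u ^ 2 * s ^ 3) ≤ u * (u ^ 2 * s ^ 3) :=
    mul_le_mul_of_nonneg_right hu1 (by positivity)
  nlinarith [h2, h3]

/-! ### Telescoping tail sums -/

/-- `Σ_{61 ≤ j < M} 1/j² ≤ 1/60`. [folklore] -/
theorem sum_inv_sq_le (M : ℕ) : ∑ j ∈ Ico 61 M, 1 / (j : ℝ) ^ 2 ≤ 1 / 60 := by
  rcases le_or_gt M 61 with hM | hM
  · rw [Finset.Ico_eq_empty_of_le hM, sum_empty]; norm_num
  · suffices h : ∀ M : ℕ, 61 ≤ M → ∑ j ∈ Ico 61 M, 1 / (j : ℝ) ^ 2 ≤ 1 / 60 - 1 / ((M : ℝ) - 1) by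
      have := h M hM.le
      have hM' : (61 : ℝ) ≤ M := by exact_mod_cast hM.le
      have : 0 ≤ 1 / ((M : ℝ) - 1) := by apply div_nonneg <;> linarith
      linarith
    intro M hM
    induction M, hM using Nat.le_induction with
    | base => norm_num
    | succ m hm ih =>
        rw [sum_Ico_succ_top (by omega), Nat.cast_succ]
        have hm' : (61 : ℝ) ≤ m := by exact_mod_cast hm
        have hstep : 1 / (m : ℝ) ^ 2 ≤ 1 / ((m : ℝ) - 1) - 1 / ((m : ℝ) + 1 - 1) := by
          rw [show (m : ℝ) + 1 - 1 = m by ring, div_sub_div _ _ (by linarith) (by linarith)]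
          rw [show (1 * (m : ℝ) - ((m : ℝ) - 1) * 1) = 1 by ring]
          apply one_div_le_one_div_of_le
          · nlinarith
          · nlinarith
        linarith [ih, hstep]

/-- `Σ_{61 ≤ j < M} 1/j³ ≤ 1/(2·60·61)`. [folklore] -/
theorem sum_inv_cube_le (M : ℕ) : ∑ j ∈ Ico 61 M, 1 / (j : ℝ) ^ 3 ≤ 1 / (2 * 60 * 61) := by
  rcases le_or_gt M 61 with hM | hM
  · rw [Finset.Ico_eq_empty_of_le hM, sum_empty]; norm_num
  · suffices h : ∀ M : ℕ, 61 ≤ M → ∑ j ∈ Ico 61 M, 1 / (j : ℝ) ^ 3 ≤ 1 / (2 * 60 * 61) - 1 / (2 * ((M : ℝ) - 1) * M) by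
      have := h M hM.le
      have hM' : (61 : ℝ) ≤ M := by exact_mod_cast hM.le
      have : 0 ≤ 1 / (2 * ((M : ℝ) - 1) * M) := by
        apply div_nonneg (by norm_num); nlinarith
      linarith
    intro M hM
    induction M, hM using Nat.le_induction with
    | base => norm_num
    | succ m hm ih =>
        rw [sum_Ico_succ_top (by omega), Nat.cast_succ]
        have hm' : (61 : ℝ) ≤ m := by exact_mod_cast hm
        have hm1 : (0 : ℝ) < (m : ℝ) - 1 := by linarith
        have hm0 : (0 : ℝ) < (m : ℝ) := by linarith
        have hstep : 1 / (m : ℝ) ^ 3 ≤ 1 / (2 * ((m : ℝ) - 1) * m) - 1 / (2 * ((m : ℝ) + 1 - 1) * ((m : ℝ) + 1)) := by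
          rw [show (m : ℝ) + 1 - 1 = m by ring,
            div_sub_div _ _ (mul_pos (mul_pos two_pos hm1) hm0).ne' (by positivity)]
          rw [div_le_div_iff₀ (by positivity) (mul_pos (mul_pos (mul_pos two_pos hm1) hm0) (by positivity))]
          nlinarith [sq_nonneg (m : ℝ), hm0, hm1]
        linarith [ih, hstep]

/-- Tail×tail convolution, squares: `Σ_{60 ≤ k < n−60} (n+1)²/((k+1)³(n−k)²) ≤ (2/61)/60 + 1/(60·61)`. [folklore] -/
theorem conv_sq_le {n : ℕ} (hn : 120 ≤ n) :
    ∑ k ∈ Ico 60 (n - 60), ((n : ℝ) + 1) ^ 2 / (((k : ℝ) + 1) ^ 3 * ((n : ℝ) - k) ^ 2)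
      ≤ 2 / 61 / 60 + 1 / (60 * 61) := by
  -- termwise: (n+1)² ≤ 2(k+1)² + 2(n-k)²
  have hterm : ∀ k ∈ Ico 60 (n - 60), ((n : ℝ) + 1) ^ 2 / (((k : ℝ) + 1) ^ 3 * ((n : ℝ) - k) ^ 2)
      ≤ 2 / 61 * (1 / ((n : ℝ) - k) ^ 2) + 2 * (1 / ((k : ℝ) + 1) ^ 3) := by
    intro k hk
    rw [mem_Ico] at hk
    have hk1 : (61 : ℝ) ≤ (k : ℝ) + 1 := by exact_mod_cast (by omega : 61 ≤ k + 1)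
    have hk2 : (61 : ℝ) ≤ (n : ℝ) - k := by
      have : ((61 + k : ℕ) : ℝ) ≤ n := by exact_mod_cast (by omega : 61 + k ≤ n)
      push_cast at this; linarith
    have ha : 0 < ((k : ℝ) + 1) := by linarith
    have hb : 0 < ((n : ℝ) - k) := by linarith
    rw [div_le_iff₀ (by positivity)]
    have e : (2 / 61 * (1 / ((n : ℝ) - k) ^ 2) + 2 * (1 / ((k : ℝ) + 1) ^ 3)) * (((k : ℝ) + 1) ^ 3 * ((n : ℝ) - k) ^ 2)
        = 2 / 61 * ((k : ℝ) + 1) ^ 3 + 2 * ((n : ℝ) - k) ^ 2 := by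
      field_simp
    rw [e]
    have h3 : 2 * ((k : ℝ) + 1) ^ 2 ≤ 2 / 61 * ((k : ℝ) + 1) ^ 3 := by
      rw [show 2 / 61 * ((k : ℝ) + 1) ^ 3 = (((k : ℝ) + 1) / 61) * (2 * ((k : ℝ) + 1) ^ 2) by ring]
      have : 1 ≤ ((k : ℝ) + 1) / 61 := by rw [le_div_iff₀ (by norm_num)]; linarith
      nlinarith
    nlinarith [h3, sq_nonneg (((k : ℝ) + 1) - ((n : ℝ) - k))]
  refine (sum_le_sum hterm).trans ?_
  rw [sum_add_distrib, ← mul_sum, ← mul_sum]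
  have hA : ∑ k ∈ Ico 60 (n - 60), 1 / ((n : ℝ) - k) ^ 2 ≤ 1 / 60 := by
    have hrefl := sum_Ico_reflect (fun j : ℕ => 1 / (j : ℝ) ^ 2) 60 (m := n - 60) (n := n) (by omega)
    have e1 : n + 1 - (n - 60) = 61 := by omega
    rw [e1] at hrefl
    have e2 : ∑ k ∈ Ico 60 (n - 60), 1 / ((n : ℝ) - k) ^ 2 = ∑ k ∈ Ico 60 (n - 60), (fun j : ℕ => 1 / (j : ℝ) ^ 2) (n - k) := by
      refine sum_congr rfl fun k hk => ?_
      rw [mem_Ico] at hk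
      simp only [Nat.cast_sub (show k ≤ n by omega)]
    rw [e2, hrefl]
    exact sum_inv_sq_le _
  have hB : ∑ k ∈ Ico 60 (n - 60), 1 / ((k : ℝ) + 1) ^ 3 ≤ 1 / (2 * 60 * 61) := by
    have hsh := sum_Ico_add' (fun j : ℕ => 1 / (j : ℝ) ^ 3) 60 (n - 60) 1
    have e2 : ∑ k ∈ Ico 60 (n - 60), 1 / ((k : ℝ) + 1) ^ 3 = ∑ k ∈ Ico 60 (n - 60), (fun j : ℕ => 1 / (j : ℝ) ^ 3) (k + 1) := by
      refine sum_congr rfl fun k _ => ?_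
      simp
    rw [e2, hsh]
    exact sum_inv_cube_le _
  have := add_le_add (mul_le_mul_of_nonneg_left hA (by norm_num : (0 : ℝ) ≤ 2 / 61))
    (mul_le_mul_of_nonneg_left hB (by norm_num : (0 : ℝ) ≤ 2))
  refine this.trans ?_
  norm_num

/-- Tail×tail convolution, cubes: `Σ_{60 ≤ k < n−60} (n+1)²/((k+1)³(n−k)³) ≤ (4/61)/(2·60·61)`. [folklore] -/
theorem conv_cube_le {n : ℕ} (hn : 120 ≤ n) :
    ∑ k ∈ Ico 60 (n - 60), ((n : ℝ) + 1) ^ 2 / (((k : ℝ) + 1) ^ 3 * ((n : ℝ) - k) ^ 3)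
      ≤ 4 / 61 / (2 * 60 * 61) := by
  have hterm : ∀ k ∈ Ico 60 (n - 60), ((n : ℝ) + 1) ^ 2 / (((k : ℝ) + 1) ^ 3 * ((n : ℝ) - k) ^ 3)
      ≤ 2 / 61 * (1 / ((n : ℝ) - k) ^ 3) + 2 / 61 * (1 / ((k : ℝ) + 1) ^ 3) := by
    intro k hk
    rw [mem_Ico] at hk
    have hk1 : (61 : ℝ) ≤ (k : ℝ) + 1 := by exact_mod_cast (by omega : 61 ≤ k + 1)
    have hk2 : (61 : ℝ) ≤ (n : ℝ) - k := by
      have : ((61 + k : ℕ) : ℝ) ≤ n := by exact_mod_cast (by omega : 61 + k ≤ n)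
      push_cast at this; linarith
    have ha : 0 < ((k : ℝ) + 1) := by linarith
    have hb : 0 < ((n : ℝ) - k) := by linarith
    rw [div_le_iff₀ (by positivity)]
    have e : (2 / 61 * (1 / ((n : ℝ) - k) ^ 3) + 2 / 61 * (1 / ((k : ℝ) + 1) ^ 3)) * (((k : ℝ) + 1) ^ 3 * ((n : ℝ) - k) ^ 3)
        = 2 / 61 * ((k : ℝ) + 1) ^ 3 + 2 / 61 * ((n : ℝ) - k) ^ 3 := by
      field_simp
    rw [e]
    have h3 : 2 * ((k : ℝ) + 1) ^ 2 ≤ 2 / 61 * ((k : ℝ) + 1) ^ 3 := by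
      rw [show 2 / 61 * ((k : ℝ) + 1) ^ 3 = (((k : ℝ) + 1) / 61) * (2 * ((k : ℝ) + 1) ^ 2) by ring]
      have : 1 ≤ ((k : ℝ) + 1) / 61 := by rw [le_div_iff₀ (by norm_num)]; linarith
      nlinarith
    have h4 : 2 * ((n : ℝ) - k) ^ 2 ≤ 2 / 61 * ((n : ℝ) - k) ^ 3 := by
      rw [show 2 / 61 * ((n : ℝ) - k) ^ 3 = (((n : ℝ) - k) / 61) * (2 * ((n : ℝ) - k) ^ 2) by ring]
      have : 1 ≤ ((n : ℝ) - k) / 61 := by rw [le_div_iff₀ (by norm_num)]; linarith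
      nlinarith
    nlinarith [h3, h4, sq_nonneg (((k : ℝ) + 1) - ((n : ℝ) - k))]
  refine (sum_le_sum hterm).trans ?_
  rw [sum_add_distrib, ← mul_sum, ← mul_sum]
  have hA : ∑ k ∈ Ico 60 (n - 60), 1 / ((n : ℝ) - k) ^ 3 ≤ 1 / (2 * 60 * 61) := by
    have hrefl := sum_Ico_reflect (fun j : ℕ => 1 / (j : ℝ) ^ 3) 60 (m := n - 60) (n := n) (by omega)
    have e1 : n + 1 - (n - 60) = 61 := by omega
    rw [e1] at hrefl
    have e2 : ∑ k ∈ Ico 60 (n - 60), 1 / ((n : ℝ) - k) ^ 3 = ∑ k ∈ Ico 60 (n - 60), (fun j : ℕ => 1 / (j : ℝ) ^ 3) (n - k) := by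
      refine sum_congr rfl fun k hk => ?_
      rw [mem_Ico] at hk
      simp only [Nat.cast_sub (show k ≤ n by omega)]
    rw [e2, hrefl]
    exact sum_inv_cube_le _
  have hB : ∑ k ∈ Ico 60 (n - 60), 1 / ((k : ℝ) + 1) ^ 3 ≤ 1 / (2 * 60 * 61) := by
    have hsh := sum_Ico_add' (fun j : ℕ => 1 / (j : ℝ) ^ 3) 60 (n - 60) 1
    have e2 : ∑ k ∈ Ico 60 (n - 60), 1 / ((k : ℝ) + 1) ^ 3 = ∑ k ∈ Ico 60 (n - 60), (fun j : ℕ => 1 / (j : ℝ) ^ 3) (k + 1) := by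
      refine sum_congr rfl fun k _ => ?_
      simp
    rw [e2, hsh]
    exact sum_inv_cube_le _
  have := add_le_add (mul_le_mul_of_nonneg_left hA (by norm_num : (0 : ℝ) ≤ 2 / 61))
    (mul_le_mul_of_nonneg_left hB (by norm_num : (0 : ℝ) ≤ 2 / 61))
  refine this.trans ?_
  norm_num

/-! ### The two explicit convolutions of the weight function -/

/-- The quadratic convolution term of the step with the weights `B`. [folklore] -/
def GG (n k : ℕ) : ℝ := (if k = 0 then (0 : ℝ) else cc (k + 1) * Bb (k + 1)) * ((n - k : ℕ) : ℝ) * Bb (n - k)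

/-- The parity convolution term of the step with the weights `B`. [folklore] -/
def HH (n k : ℕ) : ℝ := Bb (k + 1) * Bb (n - k)

/-- `λ^{n+1} = λ^i · λ^j` for `i + j = n + 1`. [folklore] -/
theorem lam_pow_split {n i j : ℕ} (h : i + j = n + 1) : (73 / 25 : ℝ) ^ (n + 1) = (73 / 25 : ℝ) ^ i * (73 / 25 : ℝ) ^ j := by
  rw [← pow_add, h]

/-- Head×tail piece of the quadratic sum: `G(n,k) ≤ (U/3)·q₁(k)` for `k < 60`. [folklore] -/
theorem GG_le_head {n k : ℕ} (hn : 200 ≤ n) (hk : k < 60) (hB1 : 0 ≤ Bb (k + 1)) :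
    GG n k ≤ UU n / 3 * ((q1Q k : ℚ) : ℝ) := by
  by_cases hk0 : k = 0
  · subst hk0; simp [GG, q1Q]
  have hnk : ((n - k : ℕ) : ℝ) = (n : ℝ) - k := by rw [Nat.cast_sub (by omega)]
  rw [Bb_of_le (show k + 1 ≤ 60 by omega)] at hB1
  unfold GG q1Q
  rw [if_neg hk0, if_neg hk0, Bb_of_le (show k + 1 ≤ 60 by omega), Bb_of_lt (show 60 < n - k by omega), hnk]
  push_cast
  rw [ccQ_cast, tQ_cast]
  unfold UU
  rw [lam_pow_split (n := n) (i := k + 1) (j := n - k) (by omega)]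
  have hnkpos : (0 : ℝ) < (n : ℝ) - k := by
    have : ((k + 1 : ℕ) : ℝ) ≤ n := by exact_mod_cast (by omega : k + 1 ≤ n)
    push_cast at this; linarith
  have h200k : (0 : ℝ) < 200 - (k : ℝ) := by
    have : ((k : ℕ) : ℝ) < 200 := by exact_mod_cast (by omega : k < 200)
    linarith
  have hn1 : (0 : ℝ) < (n : ℝ) + 1 := by positivity
  have hne1 : (n : ℝ) - k ≠ 0 := hnkpos.ne'
  have hne2 : (200 : ℝ) - (k : ℝ) ≠ 0 := h200k.ne'
  have hne3 : (n : ℝ) + 1 ≠ 0 := hn1.ne'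
  have hrs := ratio_sq hn (show k < 200 by omega)
  have key : 1 / ((n : ℝ) - k) ^ 2 ≤ 201 ^ 2 / (((n : ℝ) + 1) ^ 2 * (200 - (k : ℝ)) ^ 2) := by
    rw [div_le_div_iff₀ (by positivity) (by positivity), one_mul]
    linarith [hrs]
  have hcc := cc_nonneg (k + 1)
  have hP0 : 0 ≤ cc (k + 1) * ((hQ (k + 1) : ℚ) : ℝ) * (1 / 400000) * (73 / 25 : ℝ) ^ (n - k) :=
    mul_nonneg (mul_nonneg (mul_nonneg hcc hB1) (by norm_num)) (by positivity)
  calc _ = (cc (k + 1) * ((hQ (k + 1) : ℚ) : ℝ) * (1 / 400000) * (73 / 25 : ℝ) ^ (n - k)) * (1 / ((n : ℝ) - k) ^ 2) := by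
        field_simp
    _ ≤ (cc (k + 1) * ((hQ (k + 1) : ℚ) : ℝ) * (1 / 400000) * (73 / 25 : ℝ) ^ (n - k))
          * (201 ^ 2 / (((n : ℝ) + 1) ^ 2 * (200 - (k : ℝ)) ^ 2)) := mul_le_mul_of_nonneg_left key hP0
    _ = _ := by
        field_simp

/-- Tail×head piece of the quadratic sum: `G(n,k) ≤ (U/3)·q₂(n−k)` for `n − 60 ≤ k < n`. [folklore] -/
theorem GG_le_tail {n k : ℕ} (hn : 200 ≤ n) (hk1 : n - 60 ≤ k) (hk2 : k < n) (hB2 : 0 ≤ Bb (n - k)) :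
    GG n k ≤ UU n / 3 * ((q2Q (n - k) : ℚ) : ℝ) := by
  have hk0 : k ≠ 0 := by omega
  have hnk : ((n - k : ℕ) : ℝ) = (n : ℝ) - k := by rw [Nat.cast_sub (by omega)]
  rw [Bb_of_le (show n - k ≤ 60 by omega)] at hB2
  have hr := ratio_cube hn (show n - k ≤ 200 by omega)
  rw [hnk, show (n : ℝ) + 1 - ((n : ℝ) - k) = (k : ℝ) + 1 by ring] at hr
  unfold GG q2Q
  rw [if_neg hk0, Bb_of_lt (show 60 < k + 1 by omega), Bb_of_le (show n - k ≤ 60 by omega)]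
  push_cast
  rw [tQ_cast]
  simp only [hnk]
  unfold UU
  rw [lam_pow_split (n := n) (i := k + 1) (j := n - k) (by omega)]
  have hj1 : (1 : ℝ) ≤ (n : ℝ) - k := by
    have : ((k + 1 : ℕ) : ℝ) ≤ n := by exact_mod_cast (by omega : k + 1 ≤ n)
    push_cast at this; linarith
  have hj60 : (n : ℝ) - k ≤ 60 := by
    have : ((n : ℕ) : ℝ) ≤ ((k + 60 : ℕ) : ℝ) := by exact_mod_cast (by omega : n ≤ k + 60)
    push_cast at this; linarith
  have hkpos : (0 : ℝ) < (k : ℝ) + 1 := by positivity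
  have h201j : (0 : ℝ) < 201 - ((n : ℝ) - k) := by linarith
  have hn1 : (0 : ℝ) < (n : ℝ) + 1 := by positivity
  have hne1 : (k : ℝ) + 1 ≠ 0 := hkpos.ne'
  have hne2 : (201 : ℝ) - ((n : ℝ) - k) ≠ 0 := h201j.ne'
  have hne3 : (n : ℝ) + 1 ≠ 0 := hn1.ne'
  have key : 1 / ((k : ℝ) + 1) ^ 3 ≤ 201 ^ 2 / (((n : ℝ) + 1) ^ 2 * (201 - ((n : ℝ) - k)) ^ 3) := by
    rw [div_le_div_iff₀ (by positivity) (by positivity), one_mul]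
    linarith [hr]
  have hcc := cc_nonneg (k + 1)
  have hcc1 := cc_le_one (k + 1)
  have hQ0 : 0 ≤ 1 / 400000 * (73 / 25 : ℝ) ^ (k + 1) * ((n : ℝ) - k) * ((hQ (n - k) : ℚ) : ℝ) :=
    mul_nonneg (mul_nonneg (by positivity) (by linarith)) hB2
  calc _ = cc (k + 1) * ((1 / 400000 * (73 / 25 : ℝ) ^ (k + 1) * ((n : ℝ) - k) * ((hQ (n - k) : ℚ) : ℝ))
            * (1 / ((k : ℝ) + 1) ^ 3)) := by ring
    _ ≤ 1 * ((1 / 400000 * (73 / 25 : ℝ) ^ (k + 1) * ((n : ℝ) - k) * ((hQ (n - k) : ℚ) : ℝ))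
            * (1 / ((k : ℝ) + 1) ^ 3)) :=
        mul_le_mul_of_nonneg_right hcc1 (mul_nonneg hQ0 (by positivity))
    _ ≤ 1 * ((1 / 400000 * (73 / 25 : ℝ) ^ (k + 1) * ((n : ℝ) - k) * ((hQ (n - k) : ℚ) : ℝ))
            * (201 ^ 2 / (((n : ℝ) + 1) ^ 2 * (201 - ((n : ℝ) - k)) ^ 3))) :=
        mul_le_mul_of_nonneg_left (mul_le_mul_of_nonneg_left key hQ0) zero_le_one
    _ = _ := by
        field_simp

/-- Tail×tail piece of the quadratic sum. [folklore] -/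
theorem sum_GG_mid_le {n : ℕ} (hn : 200 ≤ n) :
    3 * ∑ k ∈ Ico 60 (n - 60), GG n k ≤ UU n * ((Q3Q : ℚ) : ℝ) := by
  have hterm : ∀ k ∈ Ico 60 (n - 60), GG n k ≤ (1 / 400000 : ℝ) ^ 2 * (73 / 25 : ℝ) ^ (n + 1) / ((n : ℝ) + 1) ^ 2 *
      (((n : ℝ) + 1) ^ 2 / (((k : ℝ) + 1) ^ 3 * ((n : ℝ) - k) ^ 2)) := by
    intro k hk
    rw [mem_Ico] at hk
    have hnk : ((n - k : ℕ) : ℝ) = (n : ℝ) - k := by rw [Nat.cast_sub (by omega)]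
    unfold GG
    rw [if_neg (by omega), Bb_of_lt (show 60 < k + 1 by omega), Bb_of_lt (show 60 < n - k by omega), hnk,
      lam_pow_split (n := n) (i := k + 1) (j := n - k) (by omega)]
    push_cast
    have hnkpos : (0 : ℝ) < (n : ℝ) - k := by
      have : ((k + 1 : ℕ) : ℝ) ≤ n := by exact_mod_cast (by omega : k + 1 ≤ n)
      push_cast at this; linarith
    have hkpos : (0 : ℝ) < (k : ℝ) + 1 := by positivity
    have hn1 : (0 : ℝ) < (n : ℝ) + 1 := by positivity
    have hne1 : (k : ℝ) + 1 ≠ 0 := hkpos.ne'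
    have hne2 : (n : ℝ) - k ≠ 0 := hnkpos.ne'
    have hne3 : (n : ℝ) + 1 ≠ 0 := hn1.ne'
    have hcc := cc_nonneg (k + 1)
    have hcc1 := cc_le_one (k + 1)
    have e : (1 / 400000 : ℝ) ^ 2 * ((73 / 25 : ℝ) ^ (k + 1) * (73 / 25 : ℝ) ^ (n - k)) / ((n : ℝ) + 1) ^ 2 *
        (((n : ℝ) + 1) ^ 2 / (((k : ℝ) + 1) ^ 3 * ((n : ℝ) - k) ^ 2))
        = 1 * (1 / 400000 * (73 / 25 : ℝ) ^ (k + 1) / ((k : ℝ) + 1) ^ 3) * ((n : ℝ) - k)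
          * (1 / 400000 * (73 / 25 : ℝ) ^ (n - k) / ((n : ℝ) - k) ^ 3) := by
      field_simp
    rw [e]
    gcongr
  refine (mul_le_mul_of_nonneg_left (sum_le_sum hterm) (by norm_num)).trans ?_
  rw [← mul_sum]
  have hconv := conv_sq_le (n := n) (by omega)
  unfold UU Q3Q
  push_cast
  rw [thetaQ_cast]
  have hpos : (0 : ℝ) ≤ (1 / 400000 : ℝ) ^ 2 * (73 / 25 : ℝ) ^ (n + 1) / ((n : ℝ) + 1) ^ 2 := by positivity
  calc 3 * ((1 / 400000 : ℝ) ^ 2 * (73 / 25 : ℝ) ^ (n + 1) / ((n : ℝ) + 1) ^ 2 *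
        ∑ k ∈ Ico 60 (n - 60), ((n : ℝ) + 1) ^ 2 / (((k : ℝ) + 1) ^ 3 * ((n : ℝ) - k) ^ 2))
      ≤ 3 * ((1 / 400000 : ℝ) ^ 2 * (73 / 25 : ℝ) ^ (n + 1) / ((n : ℝ) + 1) ^ 2 * (2 / 61 / 60 + 1 / (60 * 61))) := by
        gcongr
    _ = _ := by ring

/-- Head×tail piece of the parity sum: `H(n,k) ≤ U·p₁(k)` for `k < 60`. [folklore] -/
theorem HH_le_head {n k : ℕ} (hn : 200 ≤ n) (hk : k < 60) (hB1 : 0 ≤ Bb (k + 1)) :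
    HH n k ≤ UU n * ((p1Q k : ℚ) : ℝ) := by
  have hnk : ((n - k : ℕ) : ℝ) = (n : ℝ) - k := by rw [Nat.cast_sub (by omega)]
  rw [Bb_of_le (show k + 1 ≤ 60 by omega)] at hB1
  have hr := ratio_cube hn (show k + 1 ≤ 200 by omega)
  have e1 : (201 : ℝ) - ((k + 1 : ℕ) : ℝ) = 200 - (k : ℝ) := by push_cast; ring
  have e2 : (n : ℝ) + 1 - ((k + 1 : ℕ) : ℝ) = (n : ℝ) - k := by push_cast; ring
  rw [e1, e2] at hr
  unfold HH p1Q
  rw [Bb_of_le (show k + 1 ≤ 60 by omega), Bb_of_lt (show 60 < n - k by omega), hnk]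
  push_cast
  rw [tQ_cast]
  unfold UU
  rw [lam_pow_split (n := n) (i := k + 1) (j := n - k) (by omega)]
  have hnkpos : (0 : ℝ) < (n : ℝ) - k := by
    have : ((k + 1 : ℕ) : ℝ) ≤ n := by exact_mod_cast (by omega : k + 1 ≤ n)
    push_cast at this; linarith
  have h200k : (0 : ℝ) < 200 - (k : ℝ) := by
    have : ((k : ℕ) : ℝ) < 200 := by exact_mod_cast (by omega : k < 200)
    linarith
  have hn1 : (0 : ℝ) < (n : ℝ) + 1 := by positivity
  have hne1 : (n : ℝ) - k ≠ 0 := hnkpos.ne'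
  have hne2 : (200 : ℝ) - (k : ℝ) ≠ 0 := h200k.ne'
  have hne3 : (n : ℝ) + 1 ≠ 0 := hn1.ne'
  have key : 1 / ((n : ℝ) - k) ^ 3 ≤ 201 ^ 2 / (((n : ℝ) + 1) ^ 2 * (200 - (k : ℝ)) ^ 3) := by
    rw [div_le_div_iff₀ (by positivity) (by positivity), one_mul]
    linarith [hr]
  have hP0 : 0 ≤ ((hQ (k + 1) : ℚ) : ℝ) * (1 / 400000) * (73 / 25 : ℝ) ^ (n - k) :=
    mul_nonneg (mul_nonneg hB1 (by norm_num)) (by positivity)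
  calc _ = (((hQ (k + 1) : ℚ) : ℝ) * (1 / 400000) * (73 / 25 : ℝ) ^ (n - k)) * (1 / ((n : ℝ) - k) ^ 3) := by ring
    _ ≤ (((hQ (k + 1) : ℚ) : ℝ) * (1 / 400000) * (73 / 25 : ℝ) ^ (n - k))
          * (201 ^ 2 / (((n : ℝ) + 1) ^ 2 * (200 - (k : ℝ)) ^ 3)) := mul_le_mul_of_nonneg_left key hP0
    _ = _ := by
        field_simp

/-- Tail×head piece of the parity sum: `H(n,k) ≤ U·p₂(n−k)` for `n − 60 ≤ k < n`. [folklore] -/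
theorem HH_le_tail {n k : ℕ} (hn : 200 ≤ n) (hk1 : n - 60 ≤ k) (hk2 : k < n) (hB2 : 0 ≤ Bb (n - k)) :
    HH n k ≤ UU n * ((p2Q (n - k) : ℚ) : ℝ) := by
  have hnk : ((n - k : ℕ) : ℝ) = (n : ℝ) - k := by rw [Nat.cast_sub (by omega)]
  rw [Bb_of_le (show n - k ≤ 60 by omega)] at hB2
  have hr := ratio_cube hn (show n - k ≤ 200 by omega)
  rw [hnk, show (n : ℝ) + 1 - ((n : ℝ) - k) = (k : ℝ) + 1 by ring] at hr
  unfold HH p2Q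
  rw [if_neg (show n - k ≠ 0 by omega), Bb_of_lt (show 60 < k + 1 by omega), Bb_of_le (show n - k ≤ 60 by omega)]
  push_cast
  rw [tQ_cast]
  simp only [hnk]
  unfold UU
  rw [lam_pow_split (n := n) (i := k + 1) (j := n - k) (by omega)]
  have hj1 : (1 : ℝ) ≤ (n : ℝ) - k := by
    have : ((k + 1 : ℕ) : ℝ) ≤ n := by exact_mod_cast (by omega : k + 1 ≤ n)
    push_cast at this; linarith
  have hj60 : (n : ℝ) - k ≤ 60 := by
    have : ((n : ℕ) : ℝ) ≤ ((k + 60 : ℕ) : ℝ) := by exact_mod_cast (by omega : n ≤ k + 60)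
    push_cast at this; linarith
  have hkpos : (0 : ℝ) < (k : ℝ) + 1 := by positivity
  have h201j : (0 : ℝ) < 201 - ((n : ℝ) - k) := by linarith
  have hn1 : (0 : ℝ) < (n : ℝ) + 1 := by positivity
  have hne1 : (k : ℝ) + 1 ≠ 0 := hkpos.ne'
  have hne2 : (201 : ℝ) - ((n : ℝ) - k) ≠ 0 := h201j.ne'
  have hne3 : (n : ℝ) + 1 ≠ 0 := hn1.ne'
  have key : 1 / ((k : ℝ) + 1) ^ 3 ≤ 201 ^ 2 / (((n : ℝ) + 1) ^ 2 * (201 - ((n : ℝ) - k)) ^ 3) := by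
    rw [div_le_div_iff₀ (by positivity) (by positivity), one_mul]
    linarith [hr]
  have hP0 : 0 ≤ 1 / 400000 * (73 / 25 : ℝ) ^ (k + 1) * ((hQ (n - k) : ℚ) : ℝ) :=
    mul_nonneg (by positivity) hB2
  calc _ = (1 / 400000 * (73 / 25 : ℝ) ^ (k + 1) * ((hQ (n - k) : ℚ) : ℝ)) * (1 / ((k : ℝ) + 1) ^ 3) := by ring
    _ ≤ (1 / 400000 * (73 / 25 : ℝ) ^ (k + 1) * ((hQ (n - k) : ℚ) : ℝ))
          * (201 ^ 2 / (((n : ℝ) + 1) ^ 2 * (201 - ((n : ℝ) - k)) ^ 3)) := mul_le_mul_of_nonneg_left key hP0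
    _ = _ := by
        field_simp

/-- Tail×tail piece of the parity sum. [folklore] -/
theorem sum_HH_mid_le {n : ℕ} (hn : 200 ≤ n) :
    ∑ k ∈ Ico 60 (n - 60), HH n k ≤ UU n * ((P3Q : ℚ) : ℝ) := by
  have hterm : ∀ k ∈ Ico 60 (n - 60), HH n k ≤ (1 / 400000 : ℝ) ^ 2 * (73 / 25 : ℝ) ^ (n + 1) / ((n : ℝ) + 1) ^ 2 *
      (((n : ℝ) + 1) ^ 2 / (((k : ℝ) + 1) ^ 3 * ((n : ℝ) - k) ^ 3)) := by
    intro k hk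
    rw [mem_Ico] at hk
    have hnk : ((n - k : ℕ) : ℝ) = (n : ℝ) - k := by rw [Nat.cast_sub (by omega)]
    unfold HH
    rw [Bb_of_lt (show 60 < k + 1 by omega), Bb_of_lt (show 60 < n - k by omega), hnk,
      lam_pow_split (n := n) (i := k + 1) (j := n - k) (by omega)]
    push_cast
    have hnkpos : (0 : ℝ) < (n : ℝ) - k := by
      have : ((k + 1 : ℕ) : ℝ) ≤ n := by exact_mod_cast (by omega : k + 1 ≤ n)
      push_cast at this; linarith
    have hkpos : (0 : ℝ) < (k : ℝ) + 1 := by positivity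
    have hn1 : (0 : ℝ) < (n : ℝ) + 1 := by positivity
    have hne1 : (k : ℝ) + 1 ≠ 0 := hkpos.ne'
    have hne2 : (n : ℝ) - k ≠ 0 := hnkpos.ne'
    have hne3 : (n : ℝ) + 1 ≠ 0 := hn1.ne'
    apply le_of_eq
    field_simp
  refine (sum_le_sum hterm).trans ?_
  rw [← mul_sum]
  have hconv := conv_cube_le (n := n) (by omega)
  unfold UU P3Q
  push_cast
  rw [thetaQ_cast]
  have hpos : (0 : ℝ) ≤ (1 / 400000 : ℝ) ^ 2 * (73 / 25 : ℝ) ^ (n + 1) / ((n : ℝ) + 1) ^ 2 := by positivity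
  calc (1 / 400000 : ℝ) ^ 2 * (73 / 25 : ℝ) ^ (n + 1) / ((n : ℝ) + 1) ^ 2 *
        ∑ k ∈ Ico 60 (n - 60), ((n : ℝ) + 1) ^ 2 / (((k : ℝ) + 1) ^ 3 * ((n : ℝ) - k) ^ 3)
      ≤ (1 / 400000 : ℝ) ^ 2 * (73 / 25 : ℝ) ^ (n + 1) / ((n : ℝ) + 1) ^ 2 * (4 / 61 / (2 * 60 * 61)) := by
        gcongr
    _ = _ := by ring

/-- [folklore] -/
theorem sumQ_cast (f : ℕ → ℚ) (n : ℕ) : ((sumQ f n : ℚ) : ℝ) = ∑ k ∈ range n, ((f k : ℚ) : ℝ) := by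
  rw [sumQ_eq, Rat.cast_sum]

/-- The whole quadratic convolution: `3 Σ_{k<n} G(n,k) ≤ U·(Q₁ + Q₂ + Q₃)`. [folklore] -/
theorem sum_GG_le {n : ℕ} (hn : 200 ≤ n) (hB : ∀ i, i ≤ 60 → 0 ≤ Bb i) :
    3 * ∑ k ∈ range n, GG n k ≤ UU n * (((sumQ q1Q 60 + sumQ q2Q 61 + Q3Q : ℚ)) : ℝ) := by
  have hsplit : ∑ k ∈ range n, GG n k
      = ∑ k ∈ range 60, GG n k + ∑ k ∈ Ico 60 (n - 60), GG n k + ∑ k ∈ Ico (n - 60) n, GG n k := by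
    rw [← sum_range_add_sum_Ico _ (show 60 ≤ n by omega),
      ← sum_Ico_consecutive _ (show 60 ≤ n - 60 by omega) (show n - 60 ≤ n by omega)]
    ring
  have h1 : ∑ k ∈ range 60, GG n k ≤ UU n / 3 * ∑ k ∈ range 60, ((q1Q k : ℚ) : ℝ) := by
    rw [mul_sum]
    refine sum_le_sum fun k hk => ?_
    rw [mem_range] at hk
    exact GG_le_head hn hk (hB _ (by omega))
  have h2 := sum_GG_mid_le hn
  have h3 : ∑ k ∈ Ico (n - 60) n, GG n k ≤ UU n / 3 * ∑ k ∈ Ico (n - 60) n, ((q2Q (n - k) : ℚ) : ℝ) := by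
    rw [mul_sum]
    refine sum_le_sum fun k hk => ?_
    rw [mem_Ico] at hk
    exact GG_le_tail hn hk.1 hk.2 (hB _ (by omega))
  have hrefl : ∑ k ∈ Ico (n - 60) n, ((q2Q (n - k) : ℚ) : ℝ) = ∑ j ∈ Ico 1 61, ((q2Q j : ℚ) : ℝ) := by
    have h := sum_Ico_reflect (fun j : ℕ => ((q2Q j : ℚ) : ℝ)) (n - 60) (m := n) (n := n) (by omega)
    have e1 : n + 1 - n = 1 := by omega
    have e2 : n + 1 - (n - 60) = 61 := by omega
    rw [e1, e2] at h
    exact h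
  have h61 : ∑ j ∈ Ico 1 61, ((q2Q j : ℚ) : ℝ) = ∑ j ∈ range 61, ((q2Q j : ℚ) : ℝ) := by
    rw [← sum_range_add_sum_Ico _ (show 1 ≤ 61 by norm_num)]
    simp [q2Q]
  rw [hsplit]
  push_cast
  rw [sumQ_cast, sumQ_cast]
  rw [hrefl, h61] at h3
  have hU := (UU_pos n).le
  nlinarith [h1, h2, h3]

/-- The whole parity convolution: `Σ_{k<n} H(n,k) ≤ U·(P₁ + P₂ + P₃)`. [folklore] -/
theorem sum_HH_le {n : ℕ} (hn : 200 ≤ n) (hB : ∀ i, i ≤ 60 → 0 ≤ Bb i) :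
    ∑ k ∈ range n, HH n k ≤ UU n * (((sumQ p1Q 60 + sumQ p2Q 61 + P3Q : ℚ)) : ℝ) := by
  have hsplit : ∑ k ∈ range n, HH n k
      = ∑ k ∈ range 60, HH n k + ∑ k ∈ Ico 60 (n - 60), HH n k + ∑ k ∈ Ico (n - 60) n, HH n k := by
    rw [← sum_range_add_sum_Ico _ (show 60 ≤ n by omega),
      ← sum_Ico_consecutive _ (show 60 ≤ n - 60 by omega) (show n - 60 ≤ n by omega)]
    ring
  have h1 : ∑ k ∈ range 60, HH n k ≤ UU n * ∑ k ∈ range 60, ((p1Q k : ℚ) : ℝ) := by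
    rw [mul_sum]
    refine sum_le_sum fun k hk => ?_
    rw [mem_range] at hk
    exact HH_le_head hn hk (hB _ (by omega))
  have h2 := sum_HH_mid_le hn
  have h3 : ∑ k ∈ Ico (n - 60) n, HH n k ≤ UU n * ∑ k ∈ Ico (n - 60) n, ((p2Q (n - k) : ℚ) : ℝ) := by
    rw [mul_sum]
    refine sum_le_sum fun k hk => ?_
    rw [mem_Ico] at hk
    exact HH_le_tail hn hk.1 hk.2 (hB _ (by omega))
  have hrefl : ∑ k ∈ Ico (n - 60) n, ((p2Q (n - k) : ℚ) : ℝ) = ∑ j ∈ Ico 1 61, ((p2Q j : ℚ) : ℝ) := by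
    have h := sum_Ico_reflect (fun j : ℕ => ((p2Q j : ℚ) : ℝ)) (n - 60) (m := n) (n := n) (by omega)
    have e1 : n + 1 - n = 1 := by omega
    have e2 : n + 1 - (n - 60) = 61 := by omega
    rw [e1, e2] at h
    exact h
  have h61 : ∑ j ∈ Ico 1 61, ((p2Q j : ℚ) : ℝ) = ∑ j ∈ range 61, ((p2Q j : ℚ) : ℝ) := by
    rw [← sum_range_add_sum_Ico _ (show 1 ≤ 61 by norm_num)]
    simp [p2Q]
  rw [hsplit]
  push_cast
  rw [sumQ_cast, sumQ_cast]
  rw [hrefl, h61] at h3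
  have hU := (UU_pos n).le
  nlinarith [h1, h2, h3]

/-- The linear term: `3(|r−1| + |2−r|n)·B_n ≤ U·L₀` for `n ≥ 200`. [folklore] -/
theorem lin_le {n : ℕ} (hn : 200 ≤ n) :
    3 * ((72 : ℝ) / 625 + 556 / 625 * n) * Bb n ≤ UU n * ((L0Q : ℚ) : ℝ) := by
  rw [Bb_of_lt (show 60 < n by omega)]
  unfold UU L0Q
  push_cast
  rw [lamQ_cast, pow_succ (73 / 25 : ℝ) n]
  have hn' : (200 : ℝ) ≤ n := by exact_mod_cast hn
  have hnpos : (0 : ℝ) < n := by linarith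
  have h1 : (72 : ℝ) / 625 + 556 / 625 * n ≤ (72 / 625 / 200 + 556 / 625) * n := by nlinarith
  have h2 : ((n : ℝ) + 1) ^ 2 * 200 ^ 2 ≤ 201 ^ 2 * (n : ℝ) ^ 2 := by nlinarith
  have h3 : 0 ≤ (72 : ℝ) / 625 + 556 / 625 * n := by positivity
  have hprod := mul_le_mul h1 h2 (by positivity) (by positivity)
  have key : 3 * ((72 : ℝ) / 625 + 556 / 625 * n) / (n : ℝ) ^ 3
      ≤ (73 / 25 : ℝ) * (3 / (73 / 25) * (72 / 625 / 200 + 556 / 625) * (201 / 200) ^ 2) / ((n : ℝ) + 1) ^ 2 := by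
    rw [div_le_div_iff₀ (by positivity) (by positivity)]
    nlinarith [hprod]
  have hpow : (0 : ℝ) ≤ 1 / 400000 * (73 / 25 : ℝ) ^ n := by positivity
  calc _ = (1 / 400000 * (73 / 25 : ℝ) ^ n) * (3 * ((72 : ℝ) / 625 + 556 / 625 * n) / (n : ℝ) ^ 3) := by ring
    _ ≤ (1 / 400000 * (73 / 25 : ℝ) ^ n) *
        ((73 / 25 : ℝ) * (3 / (73 / 25) * (72 / 625 / 200 + 556 / 625) * (201 / 200) ^ 2) / ((n : ℝ) + 1) ^ 2) :=
        mul_le_mul_of_nonneg_left key hpow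
    _ = _ := by ring

/-! ### The inductive step and the growth lemma -/

/-- **The inductive step**: if `|w_i| ≤ B_i` for all `i ≤ n` (`n ≥ 200`), then `|w_{n+1}| ≤ Θλ^{n+1}/(n+1)³`.
[cite: BuckmasterCaolaboraGomezserrano2025, Prop. 2.5, eq. (2.12)] -/
theorem abs_w_step {r : ℝ} (hr : r ∈ Set.Icc ((13890041/12500000 : ℚ) : ℝ) ((697/625 : ℚ) : ℝ)) {n : ℕ} (hn : 200 ≤ n)
    (hB : ∀ i, i ≤ n → |w r 1 i| ≤ Bb i) :
    |w r 1 (n + 1)| ≤ (1 / 400000 : ℝ) * (73 / 25 : ℝ) ^ (n + 1) / ((n : ℝ) + 1) ^ 3 := by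
  have hstep := abs_w_succ_le_sharp r n
  obtain ⟨hρ, hν⟩ := window_abs hr
  have hB0 : ∀ i, i ≤ n → 0 ≤ Bb i := fun i hi => (abs_nonneg _).trans (hB i hi)
  have hB60 : ∀ i, i ≤ 60 → 0 ≤ Bb i := fun i hi => hB0 i (by omega)
  -- the three terms of the bracket
  have hL : (|r - 1| + |2 - r| * n) * |w r 1 n| ≤ ((72 : ℝ) / 625 + 556 / 625 * n) * Bb n := by
    have h1 : |r - 1| + |2 - r| * n ≤ (72 : ℝ) / 625 + 556 / 625 * n := by
      push_cast at hρ hν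
      have := mul_le_mul_of_nonneg_right hν (show (0 : ℝ) ≤ n by positivity)
      linarith
    exact mul_le_mul h1 (hB n le_rfl) (abs_nonneg _) (by positivity)
  have hQ : (∑ k ∈ range n, (if k = 0 then (0 : ℝ) else cc (k + 1) * |w r 1 (k + 1)|)
        * ((n - k : ℕ) : ℝ) * |w r 1 (n - k)|) ≤ ∑ k ∈ range n, GG n k := by
    refine sum_le_sum fun k hk => ?_
    rw [mem_range] at hk
    unfold GG
    by_cases hk0 : k = 0
    · rw [if_pos hk0, if_pos hk0]; simp
    · rw [if_neg hk0, if_neg hk0]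
      have hcc := cc_nonneg (k + 1)
      have := hB (k + 1) (by omega)
      have := hB (n - k) (by omega)
      have := hB0 (k + 1) (by omega)
      gcongr
  have hP : ∑ k ∈ range n, |w r 1 (k + 1)| * |w r 1 (n - k)| ≤ ∑ k ∈ range n, HH n k := by
    refine sum_le_sum fun k hk => ?_
    rw [mem_range] at hk
    unfold HH
    have := hB0 (k + 1) (by omega)
    exact mul_le_mul (hB (k + 1) (by omega)) (hB (n - k) (by omega)) (abs_nonneg _) this
  have hGG := sum_GG_le hn hB60
  have hHH := sum_HH_le hn hB60
  have hlin := lin_le hn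
  have hbud : (((L0Q + (sumQ q1Q 60 + sumQ q2Q 61 + Q3Q) + (sumQ p1Q 60 + sumQ p2Q 61 + P3Q) : ℚ)) : ℝ) ≤ 1 := by
    exact_mod_cast budget_ok
  push_cast at hbud hGG hHH
  have hU := UU_pos n
  -- denominators
  have hpar0 : (0 : ℝ) ≤ ((par n : ℕ) : ℝ) := by positivity
  have hpar2 : ((par n : ℕ) : ℝ) ≤ 2 := by
    unfold par; split_ifs <;> norm_num
  have hn1 : (0 : ℝ) < (n : ℝ) + 1 := by positivity
  have hden : 3 / ((n : ℝ) + 1 + (par n : ℕ)) ≤ 3 / ((n : ℝ) + 1) :=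
    div_le_div_of_nonneg_left (by norm_num) hn1 (by linarith)
  -- the bracket is bounded by U/3·(budget) ≤ U/3
  set TQ := ∑ k ∈ range n, (if k = 0 then (0 : ℝ) else cc (k + 1) * |w r 1 (k + 1)|) * ((n - k : ℕ) : ℝ) * |w r 1 (n - k)|
  set TP := ∑ k ∈ range n, |w r 1 (k + 1)| * |w r 1 (n - k)|
  set TL := (|r - 1| + |2 - r| * n) * |w r 1 n|
  have hTP0 : 0 ≤ TP := sum_nonneg fun k _ => mul_nonneg (abs_nonneg _) (abs_nonneg _)
  have hTQ0 : 0 ≤ TQ := by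
    refine sum_nonneg fun k _ => ?_
    split_ifs
    · simp
    · exact mul_nonneg (mul_nonneg (mul_nonneg (cc_nonneg _) (abs_nonneg _)) (by positivity)) (abs_nonneg _)
  have hTL0 : 0 ≤ TL := by positivity
  have hbr : TL + TQ + ((par n : ℕ) : ℝ) / 6 * TP ≤ UU n / 3 := by
    have h1 : ((par n : ℕ) : ℝ) / 6 * TP ≤ TP / 3 := by nlinarith
    have h2 : 3 * TL + 3 * TQ + TP ≤ UU n := by nlinarith [hL, hQ, hP, hGG, hHH, hlin, hbud]
    linarith
  have hbr0 : 0 ≤ TL + TQ + ((par n : ℕ) : ℝ) / 6 * TP := by positivity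
  calc |w r 1 (n + 1)| ≤ 3 / ((n : ℝ) + 1 + (par n : ℕ)) * (TL + TQ + ((par n : ℕ) : ℝ) / 6 * TP) := hstep
    _ ≤ 3 / ((n : ℝ) + 1) * (UU n / 3) := mul_le_mul hden hbr hbr0 (by positivity)
    _ = _ := by unfold UU; field_simp

/-- **The growth lemma**: `|w_i(r)| ≤ B_i` for every `i`, i.e. `|w_i| ≤ Θλ^i/i³` for all `i > 60`, on the window.
[cite: BuckmasterCaolaboraGomezserrano2025, Prop. 2.5, App. B] -/
theorem abs_w_le_Bb {r : ℝ} (hr : r ∈ Set.Icc ((13890041/12500000 : ℚ) : ℝ) ((697/625 : ℚ) : ℝ)) :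
    ∀ i, |w r 1 i| ≤ Bb i := by
  intro i
  induction i using Nat.strong_induction_on with
  | _ i ih =>
    rcases le_or_gt i 200 with hi | hi
    · exact abs_w_le_Bb_base hr hi
    · obtain ⟨n, rfl⟩ : ∃ n, i = n + 1 := ⟨i - 1, by omega⟩
      rw [Bb_of_lt (by omega)]
      push_cast
      exact abs_w_step hr (by omega) fun j hj => ih j (by omega)

/-- **Growth of the centre series beyond the certified orders**: `|w_j(r)| ≤ (1/400000)·(73/25)^j/j³` for every
`j > 60` and every `r ∈ [13890041/12500000, 697/625]`. [cite: BuckmasterCaolaboraGomezserrano2025, Prop. 2.5, App. B] -/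
theorem abs_w_le_growth {r : ℝ} (hr : r ∈ Set.Icc ((13890041/12500000 : ℚ) : ℝ) ((697/625 : ℚ) : ℝ)) {j : ℕ} (hj : 60 < j) :
    |w r 1 j| ≤ (1 / 400000 : ℝ) * (73 / 25 : ℝ) ^ j / (j : ℝ) ^ 3 := by
  have := abs_w_le_Bb hr j
  rwa [Bb_of_lt hj] at this

/-- **Weighted geometric bound at all orders**: `|w_j(r)|·(j+1)² ≤ (73/25)^j` for every `j`, on the window (the input of
the analytic package of the series on the disc `|ζ| < 25/73`). [cite: BuckmasterCaolaboraGomezserrano2025, Prop. 2.5, App. B] -/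
theorem abs_w_weight_le {r : ℝ} (hr : r ∈ Set.Icc ((13890041/12500000 : ℚ) : ℝ) ((697/625 : ℚ) : ℝ)) (j : ℕ) :
    |w r 1 j| * ((j : ℝ) + 1) ^ 2 ≤ (73 / 25 : ℝ) ^ j := by
  rcases le_or_gt j 60 with hj | hj
  · have h1 := abs_w_le_hQ hr (show j ≤ 200 by omega)
    have h2 := of_headChk 61 headChk_ok j (by omega)
    have h2' : (((hQ j * (((j : ℚ) + 1) ^ 2) : ℚ)) : ℝ) ≤ (((lamQ ^ j : ℚ)) : ℝ) := by exact_mod_cast h2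
    push_cast at h2'
    rw [lamQ_cast] at h2'
    exact (mul_le_mul_of_nonneg_right h1 (by positivity)).trans h2'
  · have h1 := abs_w_le_growth hr hj
    have hj' : (60 : ℝ) < j := by exact_mod_cast hj
    have hj3 : (0 : ℝ) < (j : ℝ) ^ 3 := by positivity
    have hw : ((j : ℝ) + 1) ^ 2 ≤ (j : ℝ) ^ 3 := by nlinarith
    have hpow : (0 : ℝ) ≤ (73 / 25 : ℝ) ^ j := by positivity
    have hne : (j : ℝ) ^ 3 ≠ 0 := hj3.ne'
    calc |w r 1 j| * ((j : ℝ) + 1) ^ 2 ≤ (1 / 400000 : ℝ) * (73 / 25 : ℝ) ^ j / (j : ℝ) ^ 3 * (j : ℝ) ^ 3 := by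
          gcongr
      _ = (1 / 400000 : ℝ) * (73 / 25 : ℝ) ^ j := by rw [div_mul_cancel₀ _ hne]
      _ ≤ (73 / 25 : ℝ) ^ j := by linarith

end CentreW2

end OriginSeries

end BuckmasterCaolaboraGomezserrano2025

end Literature.Analysis.FluidPDE
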